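/-
Copyright (c) 2026 the pub-hodgecm-mathlib formalisation cell (harness21).  Prover seat hodgecm-mathlib-K2E4-p23 (g0) (E4 base on loan to ENGINE E1), Track B ∕ K2-LIT,
h413 = `stmt-HodgeConjecture-24833`, campaign «EIS-R7-BL-SPH-2» (Bernstein–Lapid meromorphic continuation of the spherical Eisenstein series, `U(J_N)` template), brick P7 FILE A
(dealer K2E1-plan (g5), RULING «(ζ′) ADOPTED» 2026-09-04T08:34:20Z name map «P7 = K2E4-p23»; spec (ζ′) WIRING 7d1cceb628a30de8 §3 P6∕P7 «put the E ⊥ 𝒞_N lemma in P7»):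
THE EISENSTEIN SERIES IS ORTHOGONAL TO CUSP FORMS — `⟨E(f), Λ⟩_X = c_μ·[f, Λ_B]_β`, hence `= 0` when the constant term of `Λ` vanishes; every rank `N`, function level.
-/
import Literature.NumberTheory.Automorphic.UnitaryGroupBorelCosetSumUnfoldingBochnerFin   -- ★ every-rank Bochner coset unfolding `∫_X Σ'_q ψ(q̃ x̃⁻¹) = c_μ ∫ (β g).toReal • ψ g`
import Summits.HodgeConjecture.HodgeConjecture.Theorems.K2E1BorelWeightAverage            -- ★ p85760x (K2E4-p11 g3) «AVG»: `[ψ, Λ']_β = [ψ, (Λ')_B]_β` (`_of`, `_two`, `_three`)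
import Summits.HodgeConjecture.HodgeConjecture.Theorems.K2E1BorelCosetsDictionary          -- ★ (K2E1-p09 g4): `eisensteinSeriesU_eq_tsum_arithmeticBorelQuot` (p08's index = Track A's index)
import Summits.HodgeConjecture.HodgeConjecture.Theorems.K2E1MaassSelbergFourBrackets        -- ★ p857577 (K2E4-p11 g3): the pattern `⟨quotFun (Λ^T E), quotFun Λ'⟩_X`; brings the instance letters
import HarnessLib

/-!
# K2·E1 — `K2E1BLEisensteinCuspOrthogonalU` («EIS-R7-BL-SPH-2», P7 FILE A): `⟨E(f), Λ⟩_X = c_μ·[f, Λ_B]_β` and «`E ⊥ cusp forms`», every rank, function level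

Track B ∕ K2-LIT, crux h413 = `stmt-HodgeConjecture-24833`, route of record `HCCMUnconditional`; cell `hodgecm-mathlib`, squad K2, ENGINE E1, campaign «EIS-R7-BL-SPH-2» (RULING
«RE-WIRE N=3» 08:31:45Z, (ζ′) WIRING 7d1cceb628a30de8, RULING «(ζ′) ADOPTED» 08:34:20Z).  Prover seat `hodgecm-mathlib-K2E4-p23` (g0).  THEOREMS ONLY (no `def`, no `instance`, no
notation, no named-fact hypothesis, no `sorry`); lane `--supports stmt-HodgeConjecture-24833 --as helper` (count-neutral).  Closes no socket.  FILE B = `K2E1BLEisensteinInWeightedSpaceU2`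
(the name of record: `E(φ₀H^z) ∈ HX N`, holomorphy of `z ↦ ιE(z) ∈ HN N c`, and `E ⊥ 𝒞_N` in the weighted-`L²` currency of K2E4-p10's defs leaf `K2E1BLSpacesU2Defs`) lands after that leaf;
this file is the FUNCTION-LEVEL engine it wraps, typed `N`-generically (clone discipline (ζ′) §4: it serves BL-SPH-3 verbatim).

THE MATHEMATICS [MoeglinWaldspurger1995, II.1.7–II.1.8; Garrett2018, §1.10–1.11 («the two unwindings»); BernsteinLapid2019, §4 Claim 2 (Ξ₃)].  `G = U(J_N)` quasi-split over a
quadratic `E/F`, `X = G(𝔸_F) ⧸ G(F)` with an automorphic measure `μ`, `ν_G` an inversion-invariant Haar measure on `G(𝔸)`, `ν_N` one on `N(𝔸)` invariant under `B(F)`-conjugation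
(`hconj`, discharged at `N = 2, 3` by the product formula ★ `map_conj_toAdelic_eq_self_two∕_three`), `𝓕 ⊆ N(𝔸)` a fundamental domain of `N(F)` of finite positive measure, `β` a covering
weight of `B(F)♯` (★ BochnerFin token), `c_μ = unfoldingConstant G(F) count μ ν_G` (Weil's constant).  For a Borel section `f : G(𝔸) → ℂ`, left-`N(𝔸)`- and left-`B(F)`-invariant (the
campaign's `f = flatSectionU φ z`), and a Borel left-`G(F)`-invariant `Λ : G(𝔸) → ℂ` (an automorphic function; on `X` both are read through the tree's dictionary
`quotFun F [g] = F(g̃⁻¹)`), under the single `L¹` letter `∫⁻ β·‖f·conj Λ‖ dν_G < ∞`: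
* §1 `quotFun_eisensteinSeriesU_mul_conj_eq_tsum` — `E(f)(x̃⁻¹)·conj Λ(x̃⁻¹) = Σ'_{q ∈ B(F)∖G(F)} (f·conj Λ)(q̃ x̃⁻¹)` with NO summability hypothesis (index change ★
  `eisensteinSeriesU_eq_tsum_arithmeticBorelQuot`, `tsum_mul_right`, `G(F)`-invariance of `Λ`);
  **`integrable_and_integral_quotFun_eisensteinSeriesU_mul_conj_eq`** — the pairing is absolutely convergent and
  **`∫_X E(f)·conj Λ dμ = c_μ · ∫_{G(𝔸)} (β g)·f(g)·conj(Λ_B(g)) dν_G(g)`**, `Λ_B = borelConstantTerm ν_N 𝓕 Λ` — unwind `X → G(𝔸)` against `β` (★ BochnerFin), then the constant-term average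
  is free under the weight (★ AVG `integral_wt_smul_mul_conj_eq_mul_conj_borelConstantTerm_of`): the Eisenstein series pairs with an automorphic function ONLY THROUGH ITS CONSTANT TERM.
* §2 **`integral_quotFun_eisensteinSeriesU_mul_conj_eq_zero_of_borelConstantTerm_eq_zero`** — if `Λ_B ≡ 0` (a cusp form along `B`), `∫_X E(f)·conj Λ dμ = 0`: «`E ⊥ cusp`»; and the
  `ν_G`-a.e. variant `…_of_ae`.
* §3 the instances `U(J₂)` (`…_two`: campaign BL-SPH-2, P6 Claim 2 ∕ P7 (Ξ₃) ∕ P8 (13)) and `U(J₃)` (`…_three`: the BL-SPH-3 clone), `hconj` discharged.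
HONEST LABEL: HC_CM is proved only modulo the 7 printed citations (2 remaining named inputs: hLiu418 = `stmt-HodgeConjecture-24832`, h413 = `stmt-HodgeConjecture-24833`)
until rung 0 closes; this file asserts no named fact and closes no socket.
References: [MoeglinWaldspurger1995] C. Mœglin, J.-L. Waldspurger, *Spectral Decomposition and Eisenstein Series* (1995), II.1.7–II.1.8 · [Garrett2018] P. Garrett, *Modern Analysis of
Automorphic Forms by Example* 1 (2018), §1.10–1.11 · [BernsteinLapid2019] J. Bernstein, E. Lapid, *On the meromorphic continuation of Eisenstein series*, arXiv:1911.02342, §4.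
-/

set_option autoImplicit false
-- the mandated namespace repeats the single-problem summit's segment (`HodgeConjecture.HodgeConjecture`)
set_option linter.dupNamespace false

noncomputable section

open MeasureTheory Measure NumberField IsDedekindDomain Set MulAction
open scoped ENNReal NNReal ComplexConjugate
open Literature.MeasureTheory.Group Literature.NumberTheory
open Literature.NumberTheory.Automorphic Literature.NumberTheory.Automorphic.UnitaryGroup
open Summit.HodgeConjecture.HodgeConjecture.Cruxes.H413.K2E1BorelEisensteinU
open Summit.HodgeConjecture.HodgeConjecture.Cruxes.H413.K2E1BorelCosetsDictionary (eisensteinSeriesU_eq_tsum_arithmeticBorelQuot)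
open Summit.HodgeConjecture.HodgeConjecture.Cruxes.H413.K2E1BorelWeightAverage (integral_wt_smul_mul_conj_eq_mul_conj_borelConstantTerm_of)
open Summit.HodgeConjecture.HodgeConjecture.Cruxes.H413.K2E1IntertwinedSectionInvariance (map_conj_toAdelic_eq_self_two map_conj_toAdelic_eq_self_three)

namespace Summit.HodgeConjecture.HodgeConjecture.Cruxes.H413.K2E1BLEisensteinCuspOrthogonalU

variable {F E : Type} [Field F] [NumberField F] [Field E] [NumberField E] [Algebra F E] {c : E ≃ₐ[F] E} {N : ℕ}

/-! ## §1 `⟨E(f), Λ⟩_X = c_μ·[f, Λ_B]_β` — every rank -/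

section Generic

/-- **POINTWISE, NO SUMMABILITY NEEDED**: for left-`B(F)`-invariant `f` and left-`G(F)`-invariant `Λ`, at every `g ∈ G(𝔸)`:
`E(f)(g)·conj Λ(g) = Σ'_{q ∈ B(F)∖G(F)} f(q̃ g)·conj Λ(q̃ g)` in Track A's index (★ `eisensteinSeriesU_eq_tsum_arithmeticBorelQuot`, `tsum_mul_right`, `Λ(q̃ g) = Λ(g)`).
[cite: MoeglinWaldspurger1995, II.1.5] [cite: Garrett2018, §1.10] -/
theorem eisensteinSeriesU_mul_conj_eq_tsum {f Λ : (quasiSplit F E c N).Adelic → ℂ}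
    (hfB : ∀ b ∈ arithmeticBorel F E c N, ∀ x : (quasiSplit F E c N).Adelic, f ((b : (quasiSplit F E c N).Adelic) * x) = f x)
    (hΛG : ∀ (γ : (quasiSplit F E c N).arithmeticSubgroup) (x : (quasiSplit F E c N).Adelic), Λ ((γ : (quasiSplit F E c N).Adelic) * x) = Λ x)
    (g : (quasiSplit F E c N).Adelic) :
    eisensteinSeriesU f g * conj (Λ g) =
      ∑' q : Quotient (QuotientGroup.rightRel (arithmeticBorel F E c N)),
        f (((q.out : (quasiSplit F E c N).arithmeticSubgroup) : (quasiSplit F E c N).Adelic) * g) *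
          conj (Λ (((q.out : (quasiSplit F E c N).arithmeticSubgroup) : (quasiSplit F E c N).Adelic) * g)) := by
  rw [eisensteinSeriesU_eq_tsum_arithmeticBorelQuot hfB g, ← tsum_mul_right]
  exact tsum_congr fun q => by rw [hΛG]

/-- The same read on `X = G(𝔸) ⧸ G(F)` through the dictionary `quotFun F [g] = F(g̃⁻¹)`:
`quotFun (E f) x · conj (quotFun Λ x) = Σ'_{q ∈ B(F)∖G(F)} (f·conj Λ)(q̃ x̃⁻¹)`. [cite: MoeglinWaldspurger1995, II.1.5] -/
theorem quotFun_eisensteinSeriesU_mul_conj_eq_tsum {f Λ : (quasiSplit F E c N).Adelic → ℂ}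
    (hfB : ∀ b ∈ arithmeticBorel F E c N, ∀ x : (quasiSplit F E c N).Adelic, f ((b : (quasiSplit F E c N).Adelic) * x) = f x)
    (hΛG : ∀ (γ : (quasiSplit F E c N).arithmeticSubgroup) (x : (quasiSplit F E c N).Adelic), Λ ((γ : (quasiSplit F E c N).Adelic) * x) = Λ x)
    (x : (quasiSplit F E c N).automorphicQuotient) :
    (quasiSplit F E c N).quotFun (eisensteinSeriesU f) x * conj ((quasiSplit F E c N).quotFun Λ x) =
      ∑' q : Quotient (QuotientGroup.rightRel (arithmeticBorel F E c N)),
        f (((q.out : (quasiSplit F E c N).arithmeticSubgroup) : (quasiSplit F E c N).Adelic) * (Quotient.out x : (quasiSplit F E c N).Adelic)⁻¹) *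
          conj (Λ (((q.out : (quasiSplit F E c N).arithmeticSubgroup) : (quasiSplit F E c N).Adelic) * (Quotient.out x : (quasiSplit F E c N).Adelic)⁻¹)) :=
  eisensteinSeriesU_mul_conj_eq_tsum hfB hΛG _

variable [MeasurableSpace (quasiSplit F E c N).Adelic] [BorelSpace (quasiSplit F E c N).Adelic]

/-- **`⟨E(f), Λ⟩_X = c_μ·[f, Λ_B]_β` — THE EISENSTEIN SERIES PAIRS WITH AN AUTOMORPHIC FUNCTION ONLY THROUGH ITS CONSTANT TERM** (every rank `N`; `hconj` = `B(F)`-conjugation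
invariance of `ν_N`, discharged in §3).  For `f` Borel, left-`N(𝔸)`- and left-`B(F)`-invariant, `Λ` Borel and left-`G(F)`-invariant, `β` a covering weight of `B(F)♯`, and
`∫⁻ β·‖f·conj Λ‖ dν_G < ∞`: `x ↦ E(f)(x̃⁻¹)·conj Λ(x̃⁻¹)` is `μ`-integrable on `X` and
`∫_X E(f)(x̃⁻¹)·conj Λ(x̃⁻¹) dμ = c_μ · ∫_{G(𝔸)} (β g)·(f(g)·conj (Λ_B(g))) dν_G`, `Λ_B = borelConstantTerm ν_N 𝓕 Λ`, with `c_μ > 0` Weil's constant `unfoldingConstant G(F) count μ ν_G` (stated `∃ cμ > 0`, as ★ FourBrackets) — unwind `X → G(𝔸)` (★ BochnerFin)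
and average the constant term for free under the weight (★ AVG). [cite: MoeglinWaldspurger1995, II.1.7–II.1.8] [cite: Garrett2018, §1.10–1.11] -/
theorem integrable_and_integral_quotFun_eisensteinSeriesU_mul_conj_eq
    (μ : Measure (quasiSplit F E c N).automorphicQuotient) [(quasiSplit F E c N).IsAutomorphicMeasure μ]
    (νG : Measure (quasiSplit F E c N).Adelic) [νG.IsHaarMeasure] [νG.IsInvInvariant]
    (νN : Measure ↥(adelicUnipotent F E c N)) [νN.IsHaarMeasure] [νN.IsInvInvariant]
    (hconj : ∀ b₀ (hb₀ : b₀ ∈ borelU (c : E →+* E) ((StdForm.antidiagonal N).over E)),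
      νN.map (fun v : ↥(adelicUnipotent F E c N) => (⟨((quasiSplit F E c N).toAdelic b₀)⁻¹ * (v : (quasiSplit F E c N).Adelic) * (quasiSplit F E c N).toAdelic b₀,
        conj_mem_adelicUnipotent ((K2E1PseudoEisensteinConstantTermU.toAdelic_mem_borelAdelic_iff b₀).2 hb₀) v.2⟩ : ↥(adelicUnipotent F E c N))) = νN)
    {𝓕 : Set ↥(adelicUnipotent F E c N)} (h𝓕 : IsFundamentalDomain ↥(rationalUnipotent F E c N) 𝓕 νN) (h𝓕₀ : νN 𝓕 ≠ 0) (h𝓕top : νN 𝓕 ≠ ∞)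
    {β : (quasiSplit F E c N).Adelic → ℝ≥0∞} (hβ : IsCoveringWeight ↥((arithmeticBorel F E c N).map (quasiSplit F E c N).arithmeticSubgroup.subtype) β)
    {f Λ : (quasiSplit F E c N).Adelic → ℂ} (hfm : Measurable f) (hΛm : Measurable Λ)
    (hfN : ∀ (u : ↥(adelicUnipotent F E c N)) (g : (quasiSplit F E c N).Adelic), f ((u : (quasiSplit F E c N).Adelic) * g) = f g)
    (hfB : ∀ b ∈ arithmeticBorel F E c N, ∀ x : (quasiSplit F E c N).Adelic, f ((b : (quasiSplit F E c N).Adelic) * x) = f x)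
    (hΛG : ∀ (γ : (quasiSplit F E c N).arithmeticSubgroup) (x : (quasiSplit F E c N).Adelic), Λ ((γ : (quasiSplit F E c N).Adelic) * x) = Λ x)
    (hL1 : ∫⁻ g, β g * ‖f g * conj (Λ g)‖ₑ ∂νG < ∞) :
    ∃ cμ : ℝ, 0 < cμ ∧
      Integrable (fun x : (quasiSplit F E c N).automorphicQuotient =>
          (quasiSplit F E c N).quotFun (eisensteinSeriesU f) x * conj ((quasiSplit F E c N).quotFun Λ x)) μ ∧
        ∫ x, (quasiSplit F E c N).quotFun (eisensteinSeriesU f) x * conj ((quasiSplit F E c N).quotFun Λ x) ∂μ =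
          (cμ : ℂ) * ∫ g, (β g).toReal • (f g * conj (borelConstantTerm νN 𝓕 Λ g)) ∂νG := by
  classical
  -- structure on `G(𝔸)` (as in ★ BochnerFin ∕ ★ FourBrackets)
  haveI := t2Space_adeleRing_of_numberField E
  haveI := locallyCompactSpace_adeleRing' E
  haveI := secondCountableTopology_adeleRing E
  haveI : T2Space (quasiSplit F E c N).Adelic := inferInstanceAs (T2Space (adelic F E c N ((StdForm.antidiagonal N).over E)))
  haveI : LocallyCompactSpace (quasiSplit F E c N).Adelic := inferInstanceAs (LocallyCompactSpace (adelic F E c N ((StdForm.antidiagonal N).over E)))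
  haveI : SecondCountableTopology (quasiSplit F E c N).Adelic := inferInstanceAs (SecondCountableTopology (adelic F E c N ((StdForm.antidiagonal N).over E)))
  haveI : DiscreteTopology (quasiSplit F E c N).quotientSubgroup := discreteTopology_quotientSubgroup_quasiSplit
  haveI : Countable (quasiSplit F E c N).quotientSubgroup := by
    rw [quotientSubgroup_quasiSplit]; exact countable_arithmeticSubgroup_quasiSplit
  haveI : (count : Measure (quasiSplit F E c N).quotientSubgroup).IsHaarMeasure := isHaarMeasure_count_quotientSubgroup_quasiSplit
  letI := AdelicGroupData.measurableSpaceQuotientForm (quasiSplit F E c N)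
  haveI := AdelicGroupData.borelSpaceQuotientForm (quasiSplit F E c N)
  haveI := AdelicGroupData.smulInvariantMeasureQuotientForm (quasiSplit F E c N) μ
  haveI := AdelicGroupData.isFiniteMeasureOnCompactsQuotientForm (quasiSplit F E c N) μ
  have hcμ : 0 < unfoldingConstant (quasiSplit F E c N).quotientSubgroup (count : Measure (quasiSplit F E c N).quotientSubgroup) μ νG :=
    AdelicGroupData.unfoldingConstant_pos_of_isAutomorphicMeasure _ isClosed_quotientSubgroup_quasiSplit count μ νG
  -- the integrand `Ψ = f · conj Λ` is Borel and left-`B(F)`-invariant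
  have hΛB : ∀ b ∈ arithmeticBorel F E c N, ∀ x : (quasiSplit F E c N).Adelic, Λ ((b : (quasiSplit F E c N).Adelic) * x) = Λ x := fun b _ x => hΛG b x
  have hΨm : Measurable fun g : (quasiSplit F E c N).Adelic => f g * conj (Λ g) := hfm.mul (Complex.continuous_conj.measurable.comp hΛm)
  have hΨB : ∀ b ∈ arithmeticBorel F E c N, ∀ x : (quasiSplit F E c N).Adelic,
      f ((b : (quasiSplit F E c N).Adelic) * x) * conj (Λ ((b : (quasiSplit F E c N).Adelic) * x)) = f x * conj (Λ x) := fun b hb x => by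
    rw [hfB b hb x, hΛB b hb x]
  obtain ⟨hI, hE⟩ := integrable_tsum_borelQuotient_and_integral_eq_mul_integral_fin μ νG hβ hΨm hΨB hL1
  have hptX : ∀ x : (quasiSplit F E c N).automorphicQuotient,
      (quasiSplit F E c N).quotFun (eisensteinSeriesU f) x * conj ((quasiSplit F E c N).quotFun Λ x) =
        ∑' q : Quotient (QuotientGroup.rightRel (arithmeticBorel F E c N)),
          f (((q.out : (quasiSplit F E c N).arithmeticSubgroup) : (quasiSplit F E c N).Adelic) * (Quotient.out x : (quasiSplit F E c N).Adelic)⁻¹) *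
            conj (Λ (((q.out : (quasiSplit F E c N).arithmeticSubgroup) : (quasiSplit F E c N).Adelic) * (Quotient.out x : (quasiSplit F E c N).Adelic)⁻¹)) :=
    quotFun_eisensteinSeriesU_mul_conj_eq_tsum hfB hΛG
  refine ⟨(unfoldingConstant (quasiSplit F E c N).quotientSubgroup (count : Measure (quasiSplit F E c N).quotientSubgroup) μ νG : ℝ), NNReal.coe_pos.2 hcμ,
    hI.congr (ae_of_all _ fun x => (hptX x).symm), ?_⟩
  rw [integral_congr_ae (ae_of_all _ hptX), hE, integral_wt_smul_mul_conj_eq_mul_conj_borelConstantTerm_of νG νN hconj h𝓕 h𝓕₀ h𝓕top hβ hfm hΛm hfN hfB hΛB hL1]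

/-! ## §2 «`E ⊥ cusp forms`»: the constant term of `Λ` vanishes ⟹ `⟨E(f), Λ⟩_X = 0` -/

/-- **«`E ⊥ CUSP FORMS`», FUNCTION LEVEL** (every rank; Bernstein–Lapid's (Ξ₃) input, [MW] II.1.8): in the setting of §1, if the constant term of `Λ` along `B` vanishes identically
(`Λ_B ≡ 0`: `Λ` is cuspidal along the Borel), then `∫_X E(f)(x̃⁻¹)·conj Λ(x̃⁻¹) dμ = 0`. [cite: MoeglinWaldspurger1995, II.1.8] [cite: BernsteinLapid2019, §4 Claim 2] -/
theorem integral_quotFun_eisensteinSeriesU_mul_conj_eq_zero_of_borelConstantTerm_eq_zero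
    (μ : Measure (quasiSplit F E c N).automorphicQuotient) [(quasiSplit F E c N).IsAutomorphicMeasure μ]
    (νG : Measure (quasiSplit F E c N).Adelic) [νG.IsHaarMeasure] [νG.IsInvInvariant]
    (νN : Measure ↥(adelicUnipotent F E c N)) [νN.IsHaarMeasure] [νN.IsInvInvariant]
    (hconj : ∀ b₀ (hb₀ : b₀ ∈ borelU (c : E →+* E) ((StdForm.antidiagonal N).over E)),
      νN.map (fun v : ↥(adelicUnipotent F E c N) => (⟨((quasiSplit F E c N).toAdelic b₀)⁻¹ * (v : (quasiSplit F E c N).Adelic) * (quasiSplit F E c N).toAdelic b₀,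
        conj_mem_adelicUnipotent ((K2E1PseudoEisensteinConstantTermU.toAdelic_mem_borelAdelic_iff b₀).2 hb₀) v.2⟩ : ↥(adelicUnipotent F E c N))) = νN)
    {𝓕 : Set ↥(adelicUnipotent F E c N)} (h𝓕 : IsFundamentalDomain ↥(rationalUnipotent F E c N) 𝓕 νN) (h𝓕₀ : νN 𝓕 ≠ 0) (h𝓕top : νN 𝓕 ≠ ∞)
    {β : (quasiSplit F E c N).Adelic → ℝ≥0∞} (hβ : IsCoveringWeight ↥((arithmeticBorel F E c N).map (quasiSplit F E c N).arithmeticSubgroup.subtype) β)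
    {f Λ : (quasiSplit F E c N).Adelic → ℂ} (hfm : Measurable f) (hΛm : Measurable Λ)
    (hfN : ∀ (u : ↥(adelicUnipotent F E c N)) (g : (quasiSplit F E c N).Adelic), f ((u : (quasiSplit F E c N).Adelic) * g) = f g)
    (hfB : ∀ b ∈ arithmeticBorel F E c N, ∀ x : (quasiSplit F E c N).Adelic, f ((b : (quasiSplit F E c N).Adelic) * x) = f x)
    (hΛG : ∀ (γ : (quasiSplit F E c N).arithmeticSubgroup) (x : (quasiSplit F E c N).Adelic), Λ ((γ : (quasiSplit F E c N).Adelic) * x) = Λ x)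
    (hL1 : ∫⁻ g, β g * ‖f g * conj (Λ g)‖ₑ ∂νG < ∞)
    (hcusp : ∀ g : (quasiSplit F E c N).Adelic, borelConstantTerm νN 𝓕 Λ g = 0) :
    ∫ x, (quasiSplit F E c N).quotFun (eisensteinSeriesU f) x * conj ((quasiSplit F E c N).quotFun Λ x) ∂μ = 0 := by
  obtain ⟨cμ, -, -, h⟩ := integrable_and_integral_quotFun_eisensteinSeriesU_mul_conj_eq μ νG νN hconj h𝓕 h𝓕₀ h𝓕top hβ hfm hΛm hfN hfB hΛG hL1
  have h0 : (fun g : (quasiSplit F E c N).Adelic => (β g).toReal • (f g * conj (borelConstantTerm νN 𝓕 Λ g))) = fun _ => 0 := by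
    funext g
    rw [hcusp g, map_zero, mul_zero, smul_zero]
  rw [h, h0, integral_zero, mul_zero]

/-- The same under the WEAKER `ν_G`-a.e. hypothesis `Λ_B = 0` a.e. (the `L²` currency of cusp forms). [cite: MoeglinWaldspurger1995, II.1.8] [cite: BernsteinLapid2019, §4 Claim 2] -/
theorem integral_quotFun_eisensteinSeriesU_mul_conj_eq_zero_of_borelConstantTerm_ae_eq_zero
    (μ : Measure (quasiSplit F E c N).automorphicQuotient) [(quasiSplit F E c N).IsAutomorphicMeasure μ]
    (νG : Measure (quasiSplit F E c N).Adelic) [νG.IsHaarMeasure] [νG.IsInvInvariant]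
    (νN : Measure ↥(adelicUnipotent F E c N)) [νN.IsHaarMeasure] [νN.IsInvInvariant]
    (hconj : ∀ b₀ (hb₀ : b₀ ∈ borelU (c : E →+* E) ((StdForm.antidiagonal N).over E)),
      νN.map (fun v : ↥(adelicUnipotent F E c N) => (⟨((quasiSplit F E c N).toAdelic b₀)⁻¹ * (v : (quasiSplit F E c N).Adelic) * (quasiSplit F E c N).toAdelic b₀,
        conj_mem_adelicUnipotent ((K2E1PseudoEisensteinConstantTermU.toAdelic_mem_borelAdelic_iff b₀).2 hb₀) v.2⟩ : ↥(adelicUnipotent F E c N))) = νN)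
    {𝓕 : Set ↥(adelicUnipotent F E c N)} (h𝓕 : IsFundamentalDomain ↥(rationalUnipotent F E c N) 𝓕 νN) (h𝓕₀ : νN 𝓕 ≠ 0) (h𝓕top : νN 𝓕 ≠ ∞)
    {β : (quasiSplit F E c N).Adelic → ℝ≥0∞} (hβ : IsCoveringWeight ↥((arithmeticBorel F E c N).map (quasiSplit F E c N).arithmeticSubgroup.subtype) β)
    {f Λ : (quasiSplit F E c N).Adelic → ℂ} (hfm : Measurable f) (hΛm : Measurable Λ)
    (hfN : ∀ (u : ↥(adelicUnipotent F E c N)) (g : (quasiSplit F E c N).Adelic), f ((u : (quasiSplit F E c N).Adelic) * g) = f g)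
    (hfB : ∀ b ∈ arithmeticBorel F E c N, ∀ x : (quasiSplit F E c N).Adelic, f ((b : (quasiSplit F E c N).Adelic) * x) = f x)
    (hΛG : ∀ (γ : (quasiSplit F E c N).arithmeticSubgroup) (x : (quasiSplit F E c N).Adelic), Λ ((γ : (quasiSplit F E c N).Adelic) * x) = Λ x)
    (hL1 : ∫⁻ g, β g * ‖f g * conj (Λ g)‖ₑ ∂νG < ∞)
    (hcusp : ∀ᵐ g : (quasiSplit F E c N).Adelic ∂νG, borelConstantTerm νN 𝓕 Λ g = 0) :
    ∫ x, (quasiSplit F E c N).quotFun (eisensteinSeriesU f) x * conj ((quasiSplit F E c N).quotFun Λ x) ∂μ = 0 := by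
  obtain ⟨cμ, -, -, h⟩ := integrable_and_integral_quotFun_eisensteinSeriesU_mul_conj_eq μ νG νN hconj h𝓕 h𝓕₀ h𝓕top hβ hfm hΛm hfN hfB hΛG hL1
  have h0 : (fun g : (quasiSplit F E c N).Adelic => (β g).toReal • (f g * conj (borelConstantTerm νN 𝓕 Λ g))) =ᵐ[νG] fun _ => 0 := by
    filter_upwards [hcusp] with g hg
    rw [hg, map_zero, mul_zero, smul_zero]
  rw [h, integral_congr_ae h0, integral_zero, mul_zero]

end Generic

/-! ## §3 The instances `U(J₂)` (campaign BL-SPH-2) and `U(J₃)` (the BL-SPH-3 clone): `hconj` discharged -/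

section Two

variable [MeasurableSpace (quasiSplit F E c 2).Adelic] [BorelSpace (quasiSplit F E c 2).Adelic]

/-- **`U(J₂)`: `⟨E(f), Λ⟩_X = c_μ·[f, Λ_B]_β`** (`c² = 1`, `c ≠ 1`; `hconj` by ★ `map_conj_toAdelic_eq_self_two`). [cite: MoeglinWaldspurger1995, II.1.7–II.1.8] [cite: Garrett2018, §1.10–1.11] -/
theorem integrable_and_integral_quotFun_eisensteinSeriesU_mul_conj_eq_two (hc : c * c = 1) (hc1 : c ≠ 1)
    (μ : Measure (quasiSplit F E c 2).automorphicQuotient) [(quasiSplit F E c 2).IsAutomorphicMeasure μ]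
    (νG : Measure (quasiSplit F E c 2).Adelic) [νG.IsHaarMeasure] [νG.IsInvInvariant]
    (νN : Measure ↥(adelicUnipotent F E c 2)) [νN.IsHaarMeasure] [νN.IsInvInvariant]
    {𝓕 : Set ↥(adelicUnipotent F E c 2)} (h𝓕 : IsFundamentalDomain ↥(rationalUnipotent F E c 2) 𝓕 νN) (h𝓕₀ : νN 𝓕 ≠ 0) (h𝓕top : νN 𝓕 ≠ ∞)
    {β : (quasiSplit F E c 2).Adelic → ℝ≥0∞} (hβ : IsCoveringWeight ↥((arithmeticBorel F E c 2).map (quasiSplit F E c 2).arithmeticSubgroup.subtype) β)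
    {f Λ : (quasiSplit F E c 2).Adelic → ℂ} (hfm : Measurable f) (hΛm : Measurable Λ)
    (hfN : ∀ (u : ↥(adelicUnipotent F E c 2)) (g : (quasiSplit F E c 2).Adelic), f ((u : (quasiSplit F E c 2).Adelic) * g) = f g)
    (hfB : ∀ b ∈ arithmeticBorel F E c 2, ∀ x : (quasiSplit F E c 2).Adelic, f ((b : (quasiSplit F E c 2).Adelic) * x) = f x)
    (hΛG : ∀ (γ : (quasiSplit F E c 2).arithmeticSubgroup) (x : (quasiSplit F E c 2).Adelic), Λ ((γ : (quasiSplit F E c 2).Adelic) * x) = Λ x)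
    (hL1 : ∫⁻ g, β g * ‖f g * conj (Λ g)‖ₑ ∂νG < ∞) :
    ∃ cμ : ℝ, 0 < cμ ∧
      Integrable (fun x : (quasiSplit F E c 2).automorphicQuotient =>
          (quasiSplit F E c 2).quotFun (eisensteinSeriesU f) x * conj ((quasiSplit F E c 2).quotFun Λ x)) μ ∧
        ∫ x, (quasiSplit F E c 2).quotFun (eisensteinSeriesU f) x * conj ((quasiSplit F E c 2).quotFun Λ x) ∂μ =
          (cμ : ℂ) * ∫ g, (β g).toReal • (f g * conj (borelConstantTerm νN 𝓕 Λ g)) ∂νG :=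
  integrable_and_integral_quotFun_eisensteinSeriesU_mul_conj_eq μ νG νN (fun _ hb₀ => map_conj_toAdelic_eq_self_two hc hc1 νN hb₀) h𝓕 h𝓕₀ h𝓕top hβ hfm hΛm hfN hfB hΛG hL1

/-- **`U(J₂)`: «`E ⊥ cusp forms`»** — `Λ_B ≡ 0 ⟹ ∫_X E(f)·conj Λ dμ = 0` (`c² = 1`, `c ≠ 1`).  Bernstein–Lapid's (Ξ₃) input for BL-SPH-2 (P6 Claim 2, P7, P8 (13)).
[cite: MoeglinWaldspurger1995, II.1.8] [cite: BernsteinLapid2019, §4 Claim 2] -/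
theorem integral_quotFun_eisensteinSeriesU_mul_conj_eq_zero_two (hc : c * c = 1) (hc1 : c ≠ 1)
    (μ : Measure (quasiSplit F E c 2).automorphicQuotient) [(quasiSplit F E c 2).IsAutomorphicMeasure μ]
    (νG : Measure (quasiSplit F E c 2).Adelic) [νG.IsHaarMeasure] [νG.IsInvInvariant]
    (νN : Measure ↥(adelicUnipotent F E c 2)) [νN.IsHaarMeasure] [νN.IsInvInvariant]
    {𝓕 : Set ↥(adelicUnipotent F E c 2)} (h𝓕 : IsFundamentalDomain ↥(rationalUnipotent F E c 2) 𝓕 νN) (h𝓕₀ : νN 𝓕 ≠ 0) (h𝓕top : νN 𝓕 ≠ ∞)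
    {β : (quasiSplit F E c 2).Adelic → ℝ≥0∞} (hβ : IsCoveringWeight ↥((arithmeticBorel F E c 2).map (quasiSplit F E c 2).arithmeticSubgroup.subtype) β)
    {f Λ : (quasiSplit F E c 2).Adelic → ℂ} (hfm : Measurable f) (hΛm : Measurable Λ)
    (hfN : ∀ (u : ↥(adelicUnipotent F E c 2)) (g : (quasiSplit F E c 2).Adelic), f ((u : (quasiSplit F E c 2).Adelic) * g) = f g)
    (hfB : ∀ b ∈ arithmeticBorel F E c 2, ∀ x : (quasiSplit F E c 2).Adelic, f ((b : (quasiSplit F E c 2).Adelic) * x) = f x)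
    (hΛG : ∀ (γ : (quasiSplit F E c 2).arithmeticSubgroup) (x : (quasiSplit F E c 2).Adelic), Λ ((γ : (quasiSplit F E c 2).Adelic) * x) = Λ x)
    (hL1 : ∫⁻ g, β g * ‖f g * conj (Λ g)‖ₑ ∂νG < ∞)
    (hcusp : ∀ᵐ g : (quasiSplit F E c 2).Adelic ∂νG, borelConstantTerm νN 𝓕 Λ g = 0) :
    ∫ x, (quasiSplit F E c 2).quotFun (eisensteinSeriesU f) x * conj ((quasiSplit F E c 2).quotFun Λ x) ∂μ = 0 :=
  integral_quotFun_eisensteinSeriesU_mul_conj_eq_zero_of_borelConstantTerm_ae_eq_zero μ νG νN (fun _ hb₀ => map_conj_toAdelic_eq_self_two hc hc1 νN hb₀)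
    h𝓕 h𝓕₀ h𝓕top hβ hfm hΛm hfN hfB hΛG hL1 hcusp

end Two

section Three

variable [MeasurableSpace (quasiSplit F E c 3).Adelic] [BorelSpace (quasiSplit F E c 3).Adelic]

/-- **`U(J₃)`: `⟨E(f), Λ⟩_X = c_μ·[f, Λ_B]_β`** (`c² = 1`, `c ≠ 1`; `hconj` by ★ `map_conj_toAdelic_eq_self_three`) — the BL-SPH-3 clone's input. [cite: MoeglinWaldspurger1995, II.1.7–II.1.8]
[cite: Garrett2018, §1.10–1.11] -/
theorem integrable_and_integral_quotFun_eisensteinSeriesU_mul_conj_eq_three (hc : c * c = 1) (hc1 : c ≠ 1)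
    (μ : Measure (quasiSplit F E c 3).automorphicQuotient) [(quasiSplit F E c 3).IsAutomorphicMeasure μ]
    (νG : Measure (quasiSplit F E c 3).Adelic) [νG.IsHaarMeasure] [νG.IsInvInvariant]
    (νN : Measure ↥(adelicUnipotent F E c 3)) [νN.IsHaarMeasure] [νN.IsInvInvariant]
    {𝓕 : Set ↥(adelicUnipotent F E c 3)} (h𝓕 : IsFundamentalDomain ↥(rationalUnipotent F E c 3) 𝓕 νN) (h𝓕₀ : νN 𝓕 ≠ 0) (h𝓕top : νN 𝓕 ≠ ∞)
    {β : (quasiSplit F E c 3).Adelic → ℝ≥0∞} (hβ : IsCoveringWeight ↥((arithmeticBorel F E c 3).map (quasiSplit F E c 3).arithmeticSubgroup.subtype) β)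
    {f Λ : (quasiSplit F E c 3).Adelic → ℂ} (hfm : Measurable f) (hΛm : Measurable Λ)
    (hfN : ∀ (u : ↥(adelicUnipotent F E c 3)) (g : (quasiSplit F E c 3).Adelic), f ((u : (quasiSplit F E c 3).Adelic) * g) = f g)
    (hfB : ∀ b ∈ arithmeticBorel F E c 3, ∀ x : (quasiSplit F E c 3).Adelic, f ((b : (quasiSplit F E c 3).Adelic) * x) = f x)
    (hΛG : ∀ (γ : (quasiSplit F E c 3).arithmeticSubgroup) (x : (quasiSplit F E c 3).Adelic), Λ ((γ : (quasiSplit F E c 3).Adelic) * x) = Λ x)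
    (hL1 : ∫⁻ g, β g * ‖f g * conj (Λ g)‖ₑ ∂νG < ∞) :
    ∃ cμ : ℝ, 0 < cμ ∧
      Integrable (fun x : (quasiSplit F E c 3).automorphicQuotient =>
          (quasiSplit F E c 3).quotFun (eisensteinSeriesU f) x * conj ((quasiSplit F E c 3).quotFun Λ x)) μ ∧
        ∫ x, (quasiSplit F E c 3).quotFun (eisensteinSeriesU f) x * conj ((quasiSplit F E c 3).quotFun Λ x) ∂μ =
          (cμ : ℂ) * ∫ g, (β g).toReal • (f g * conj (borelConstantTerm νN 𝓕 Λ g)) ∂νG :=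
  integrable_and_integral_quotFun_eisensteinSeriesU_mul_conj_eq μ νG νN (fun _ hb₀ => map_conj_toAdelic_eq_self_three hc hc1 νN hb₀) h𝓕 h𝓕₀ h𝓕top hβ hfm hΛm hfN hfB hΛG hL1

/-- **`U(J₃)`: «`E ⊥ cusp forms`»** — `Λ_B = 0` a.e. ⟹ `∫_X E(f)·conj Λ dμ = 0` (`c² = 1`, `c ≠ 1`). [cite: MoeglinWaldspurger1995, II.1.8] [cite: BernsteinLapid2019, §4 Claim 2] -/
theorem integral_quotFun_eisensteinSeriesU_mul_conj_eq_zero_three (hc : c * c = 1) (hc1 : c ≠ 1)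
    (μ : Measure (quasiSplit F E c 3).automorphicQuotient) [(quasiSplit F E c 3).IsAutomorphicMeasure μ]
    (νG : Measure (quasiSplit F E c 3).Adelic) [νG.IsHaarMeasure] [νG.IsInvInvariant]
    (νN : Measure ↥(adelicUnipotent F E c 3)) [νN.IsHaarMeasure] [νN.IsInvInvariant]
    {𝓕 : Set ↥(adelicUnipotent F E c 3)} (h𝓕 : IsFundamentalDomain ↥(rationalUnipotent F E c 3) 𝓕 νN) (h𝓕₀ : νN 𝓕 ≠ 0) (h𝓕top : νN 𝓕 ≠ ∞)
    {β : (quasiSplit F E c 3).Adelic → ℝ≥0∞} (hβ : IsCoveringWeight ↥((arithmeticBorel F E c 3).map (quasiSplit F E c 3).arithmeticSubgroup.subtype) β)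
    {f Λ : (quasiSplit F E c 3).Adelic → ℂ} (hfm : Measurable f) (hΛm : Measurable Λ)
    (hfN : ∀ (u : ↥(adelicUnipotent F E c 3)) (g : (quasiSplit F E c 3).Adelic), f ((u : (quasiSplit F E c 3).Adelic) * g) = f g)
    (hfB : ∀ b ∈ arithmeticBorel F E c 3, ∀ x : (quasiSplit F E c 3).Adelic, f ((b : (quasiSplit F E c 3).Adelic) * x) = f x)
    (hΛG : ∀ (γ : (quasiSplit F E c 3).arithmeticSubgroup) (x : (quasiSplit F E c 3).Adelic), Λ ((γ : (quasiSplit F E c 3).Adelic) * x) = Λ x)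
    (hL1 : ∫⁻ g, β g * ‖f g * conj (Λ g)‖ₑ ∂νG < ∞)
    (hcusp : ∀ᵐ g : (quasiSplit F E c 3).Adelic ∂νG, borelConstantTerm νN 𝓕 Λ g = 0) :
    ∫ x, (quasiSplit F E c 3).quotFun (eisensteinSeriesU f) x * conj ((quasiSplit F E c 3).quotFun Λ x) ∂μ = 0 :=
  integral_quotFun_eisensteinSeriesU_mul_conj_eq_zero_of_borelConstantTerm_ae_eq_zero μ νG νN (fun _ hb₀ => map_conj_toAdelic_eq_self_three hc hc1 νN hb₀)
    h𝓕 h𝓕₀ h𝓕top hβ hfm hΛm hfN hfB hΛG hL1 hcusp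

end Three

end Summit.HodgeConjecture.HodgeConjecture.Cruxes.H413.K2E1BLEisensteinCuspOrthogonalU

end
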